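import Mathlib
import HarnessLib
import Literature.AlgebraicGeometry.Resolution.AffineBlowupCartier
import Literature.AlgebraicGeometry.Resolution.BlowupChartRsop
import Literature.AlgebraicGeometry.Resolution.ProjectiveSpaceRegular

/-!
# Points of a Rees chart of an affine blowing up: stalk generators and regularity
(crux stmt-ResolutionOfSingularities-15640 `WildQuotients.WildQuotientResolution`, line `Sketch`;
chain w45c programme V3U, bricks I-4/I-5 of `L/w45c/CHAIN.md` v5 §4 lead-1 row (inputs `hregb`,
`hdivb` of `ToricExit.toricExitTransfer`, p487969); [OURS · L1 W4.5c] — NOT a statement of any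
manuscript.)

For `V = Bl_I(Spec R)` (`affineBlowup I`), `b ∈ I`, and a point `v = chartι_b(w)` of the Rees chart
`D₊(bt) ≅ Spec (R[It])_{(bt)}`:

* `ToricExit.stalkMap_chartι_stalkMap_germ` — the stalk dictionary: under the isomorphism
  `chartι_b^♯_w : 𝒪_{V,v} ≅ 𝒪_{Spec (R[It])_{(bt)}, w}` the element `π^♯_v (germ F)` goes to the
  germ of `φ_b(F)` (`φ_b = reesChartBase`);
* `ToricExit.stalkMap_germ_mem_span_of_chart` — if `φ_b(F₁) = φ_b(F₂) · u` in the chart ring then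
  `π^♯_v (germ F₁) ∈ (π^♯_v (germ F₂)) · 𝒪_{V,v}`; in particular (`F₁ = b' ∈ I`, `F₂ = b`):
  over the chart `D₊(bt)` every element of `I` is a multiple of `b` in the stalk — for
  `I₂ = (x_a, x_b²)` and `b = x_b²` this is the hypothesis `x_a ∈ (x_b²)·𝒪_{V,v}` of
  `ToricExit.I2.isPrincipal_stalkAug_liftAction_of_mem` (p486940);
* `ToricExit.isRegularLocalRing_stalk_chartι` — if the chart ring is a regular ring, the stalks of
  `V` at the points of the chart are regular local rings.
-/

-- single-problem summit: the doubled namespace component `ResolutionOfSingularities` is forced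
set_option linter.dupNamespace false

noncomputable section

open CategoryTheory AlgebraicGeometry TopologicalSpace HomogeneousLocalization
open Literature.AlgebraicGeometry.Resolution

namespace Summit.ResolutionOfSingularities.ResolutionOfSingularities.Theorems.WildQuotientResolution.ToricExit

universe u

variable {R : Type u} [CommRing R] {I : Ideal R} (b : R) (hb : b ∈ I)

/-- **The stalk map of `Spec φ` on germs of global sections**: for a ring map `φ : R → A` and a
point `w` of `Spec A`, `(Spec φ)^♯_w (germ F) = germ (φ F)` (through `ΓSpecIso`). [folklore] -/
theorem stalkMap_specMap_germ {A : Type u} [CommRing A] (φ : R →+* A) (w : Spec (CommRingCat.of A))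
    (F : R) :
    ((Spec.map (CommRingCat.ofHom φ)).stalkMap w).hom
      (((Scheme.ΓSpecIso (CommRingCat.of R)).inv ≫
        (Spec (CommRingCat.of R)).presheaf.germ ⊤
          ((Spec.map (CommRingCat.ofHom φ)).base w) trivial).hom F) =
    ((Scheme.ΓSpecIso (CommRingCat.of A)).inv ≫
      (Spec (CommRingCat.of A)).presheaf.germ ⊤ w trivial).hom (φ F) := by
  rw [CommRingCat.comp_apply, CommRingCat.comp_apply, Scheme.Hom.germ_stalkMap_apply]
  have h1 : ((Spec.map (CommRingCat.ofHom φ)).app ⊤).hom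
      ((Scheme.ΓSpecIso (CommRingCat.of R)).inv.hom F) =
      (Scheme.ΓSpecIso (CommRingCat.of A)).inv.hom (φ F) := by
    have h := congrArg (fun k : CommRingCat.of R ⟶ _ => k.hom F)
      (Scheme.ΓSpecIso_inv_naturality (CommRingCat.ofHom φ))
    exact h.symm
  rw [h1]
  rfl

/-- **The stalk dictionary on a Rees chart.** For `v = chartι_b w`:
`chartι_b^♯_w (π^♯_v (germ F)) = germ (φ_b F)`. [folklore] -/
theorem stalkMap_chartι_stalkMap_germ (w : Spec (CommRingCat.of (Away (reesGrading I) (reesT b hb))))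
    (F : R) :
    ((affineBlowup.chartι (I := I) b hb).stalkMap w).hom
      (((affineBlowup.π I).stalkMap ((affineBlowup.chartι (I := I) b hb).base w)).hom
        (((Scheme.ΓSpecIso (CommRingCat.of R)).inv ≫
          (Spec (CommRingCat.of R)).presheaf.germ ⊤
            ((affineBlowup.π I).base ((affineBlowup.chartι (I := I) b hb).base w)) trivial).hom F)) =
    ((Scheme.ΓSpecIso (CommRingCat.of (Away (reesGrading I) (reesT b hb)))).inv ≫
      (Spec (CommRingCat.of (Away (reesGrading I) (reesT b hb)))).presheaf.germ ⊤ w trivial).hom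
        (reesChartBase b hb F) := by
  have key : ∀ (f : Spec (CommRingCat.of (Away (reesGrading I) (reesT b hb))) ⟶
      Spec (CommRingCat.of R)), f = Spec.map (CommRingCat.ofHom (reesChartBase b hb)) →
      (f.stalkMap w).hom (((Scheme.ΓSpecIso (CommRingCat.of R)).inv ≫
        (Spec (CommRingCat.of R)).presheaf.germ ⊤ (f.base w) trivial).hom F) =
      ((Scheme.ΓSpecIso (CommRingCat.of (Away (reesGrading I) (reesT b hb)))).inv ≫
        (Spec (CommRingCat.of (Away (reesGrading I) (reesT b hb)))).presheaf.germ ⊤ w trivial).hom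
          (reesChartBase b hb F) := by
    intro f hf
    subst hf
    exact stalkMap_specMap_germ (reesChartBase b hb) w F
  rw [← CommRingCat.comp_apply (((affineBlowup.π I).stalkMap _)), ← Scheme.Hom.stalkMap_comp]
  exact key _ (affineBlowup.chartι_π b hb)

/-- **Over the chart `D₊(bt)`, relations `φ_b F₁ = φ_b F₂ · u` of the chart ring hold in the stalks
of the blowing up**: `π^♯_v (germ F₁) ∈ (π^♯_v (germ F₂))` at `v = chartι_b w`. (Transport along
the isomorphism `chartι_b^♯_w`.) [folklore] -/
theorem stalkMap_germ_mem_span_of_chart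
    (w : Spec (CommRingCat.of (Away (reesGrading I) (reesT b hb)))) (F₁ F₂ : R)
    (u : Away (reesGrading I) (reesT b hb))
    (hu : reesChartBase b hb F₁ = reesChartBase b hb F₂ * u) :
    ((affineBlowup.π I).stalkMap ((affineBlowup.chartι (I := I) b hb).base w)).hom
        (((Scheme.ΓSpecIso (CommRingCat.of R)).inv ≫
          (Spec (CommRingCat.of R)).presheaf.germ ⊤
            ((affineBlowup.π I).base ((affineBlowup.chartι (I := I) b hb).base w)) trivial).hom F₁) ∈
      Ideal.span {((affineBlowup.π I).stalkMap ((affineBlowup.chartι (I := I) b hb).base w)).hom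
        (((Scheme.ΓSpecIso (CommRingCat.of R)).inv ≫
          (Spec (CommRingCat.of R)).presheaf.germ ⊤
            ((affineBlowup.π I).base ((affineBlowup.chartι (I := I) b hb).base w)) trivial).hom F₂)} := by
  -- the stalk map of the open immersion `chartι` is an isomorphism
  let e := (asIso ((affineBlowup.chartι (I := I) b hb).stalkMap w)).commRingCatIsoToRingEquiv
  have he : ∀ x, e x = ((affineBlowup.chartι (I := I) b hb).stalkMap w).hom x := fun x => rfl
  refine Ideal.mem_span_singleton'.mpr ⟨e.symm (((Scheme.ΓSpecIso (CommRingCat.of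
      (Away (reesGrading I) (reesT b hb)))).inv ≫
    (Spec (CommRingCat.of (Away (reesGrading I) (reesT b hb)))).presheaf.germ ⊤ w trivial).hom u), ?_⟩
  apply e.injective
  rw [map_mul, e.apply_symm_apply, he, he, stalkMap_chartι_stalkMap_germ, stalkMap_chartι_stalkMap_germ,
    hu, map_mul, mul_comm]

/-- **The stalks of the blowing up at the points of a regular chart are regular.** [folklore] -/
theorem isRegularLocalRing_stalk_chartι [IsRegularRing (Away (reesGrading I) (reesT b hb))]
    (w : Spec (CommRingCat.of (Away (reesGrading I) (reesT b hb)))) :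
    IsRegularLocalRing ((affineBlowup I).presheaf.stalk ((affineBlowup.chartι (I := I) b hb).base w)) := by
  haveI := Scheme.isRegular_Spec (CommRingCat.of (Away (reesGrading I) (reesT b hb))) w
  exact IsRegularLocalRing.of_ringEquiv
    (asIso ((affineBlowup.chartι (I := I) b hb).stalkMap w)).commRingCatIsoToRingEquiv.symm

end Summit.ResolutionOfSingularities.ResolutionOfSingularities.Theorems.WildQuotientResolution.ToricExit

end
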